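import Summits.HubbardSuperconductivity.HubbardSuperconductivity.Theorems.NodalWardXYDefs
import Summits.HubbardSuperconductivity.HubbardSuperconductivity.Theorems.NodalWardXYPerturbedXYOrderEntire
import Summits.HubbardSuperconductivity.HubbardSuperconductivity.Theorems.NodalWardXYPerturbedXYOrderSchwarzInheritance
import Summits.HubbardSuperconductivity.HubbardSuperconductivity.Theorems.NodalWardXYPerturbedXYOrderStabilityOfTaylorBounds
import Summits.HubbardSuperconductivity.HubbardSuperconductivity.Theorems.NodalWardXYPerturbedXYOrderRealPlateauEven
import Summits.HubbardSuperconductivity.HubbardSuperconductivity.Theorems.NodalWardXYPerturbedXYOrderRealPlateauOdd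
import Summits.HubbardSuperconductivity.HubbardSuperconductivity.Theorems.NodalWardXYPerturbedXYOrderTwoPointNonneg

/-!
# `PerturbedXYOrder` (stmt-HubbardSuperconductivity-10739) — line `schwarz-inheritance`: the reduction, assembled

Crux (route `NodalWardXY`, rank 3): `Summit.HubbardSuperconductivity.HubbardSuperconductivity.Theses.NodalWardXY.PerturbedXYOrder`
— the classical XY model on `(ℤ/Lℤ)³` at `J ≥ J₀`, perturbed by `exp(W_K)` with a complex two-current kernel
`‖K(b,b')‖ ≤ ε(1+dist)⁻⁴`, has `Z_K ≠ 0` and plateau `Re[num/Z_K/L⁶] ≥ a > 0`, uniformly in `L ≥ 2`.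

This file assembles the six landed stubs of the line (`stub_realPlateauEven`, `stub_realPlateauOdd`, `stub_twoPointNonneg`,
`stub_entire`, `stub_schwarzInheritance`, `stub_stabilityOfTaylorBounds`, all in this namespace) into:

* `realPlateau` — **Milestone 0 of the crux (`K = 0`) for ALL tori `L ≥ 2`**: `a₀ ≤ Re cratio L J 0` for `J ≥ J₁`
  (even `L ≥ 4`: Fröhlich–Simon–Spencer infrared bound; odd `L ≥ L₁`: Garban–Spencer + Ginibre; small tori: Griffiths' first
  inequality and the diagonal, `inv_cube_le_re_cratio_zero`); together with `norm_cratio_zero_le_one`.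
* `complexStability_of_cumulantBounds` — Gevrey-1 bounds on the Taylor coefficients at `t = 0` of `log(Z(tK)/Z(0))` (`× L³`) and of
  `cratio(tK)` at radius `ε₁` give zero-freeness and `‖cratio‖ ≤ 2` at radius `ε₁/(2A)`.
* `perturbedXYOrder_of_cumulantBounds` — **the crux follows from those cumulant bounds** (Schwarz inheritance with `B = 2`):
  `PerturbedXYOrder` with `ε = ε₁/(2A) · a₀/8`, `a = a₀/2`.

So the complex, non-local crux is reduced to ONE statement about the REAL low-temperature rotator measure `μ_{J,L}`: uniform-in-`L`
`n! Aⁿ` bounds on the cumulants of `W_K` (per volume) and on the mixed cumulants of `W_K` with the order observable — the registered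
stub `stub_cumulantBounds` of `Cruxes/PerturbedXYOrder/Lines/schwarz-inheritance.lean` (crux-sized: by Borel–Carathéodory it is
equivalent to the crux on a larger radius, drefute note `Cruxes/PerturbedXYOrder/DrefuteSchwarzInheritance.md` §3).
-/

noncomputable section

namespace Summit.HubbardSuperconductivity.HubbardSuperconductivity.Theorems.PerturbedXYOrder

open MeasureTheory Literature.Probability.LatticeModels
open Summit.HubbardSuperconductivity.HubbardSuperconductivity.Theses.NodalWardXY

variable {L : ℕ}

/-! ### Elementary facts about the `K = 0` objects -/

/-- The unperturbed real weight `e^{J Σ_b cos ∇_b θ}` is continuous in `θ`. -/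
theorem continuous_xyWeight [NeZero L] (J : ℝ) :
    Continuous fun θ : TorusSite 3 L → ℝ =>
      Real.exp (J * ∑ b : TorusSite 3 L × Fin 3, Real.cos (θ (b.1 + Pi.single b.2 1) - θ b.1)) := by
  fun_prop

/-- The cube `[0,2π]^Λ` has positive Lebesgue measure. -/
theorem volume_cube_pos [NeZero L] : 0 < MeasureTheory.volume (cube L) := by
  unfold cube
  rw [MeasureTheory.volume_pi_pi]
  refine pos_iff_ne_zero.2 (Finset.prod_ne_zero_iff.2 fun x _ => ?_)
  rw [Real.volume_Icc]
  exact (ENNReal.ofReal_pos.2 (by linarith [Real.pi_pos])).ne'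

/-- The real unperturbed partition function `∫_{[0,2π]^Λ} e^{J Σ cos} dθ` is positive. -/
theorem integral_xyWeight_pos [NeZero L] (J : ℝ) :
    0 < ∫ θ in cube L,
      Real.exp (J * ∑ b : TorusSite 3 L × Fin 3, Real.cos (θ (b.1 + Pi.single b.2 1) - θ b.1)) := by
  have hint : IntegrableOn (fun θ : TorusSite 3 L → ℝ =>
      Real.exp (J * ∑ b : TorusSite 3 L × Fin 3, Real.cos (θ (b.1 + Pi.single b.2 1) - θ b.1))) (cube L) volume :=
    (continuous_xyWeight J).continuousOn.integrableOn_compact ent_isCompact_cube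
  rw [integral_pos_iff_support_of_nonneg (fun θ => (Real.exp_pos _).le) hint]
  have hsupp : Function.support (fun θ : TorusSite 3 L → ℝ =>
      Real.exp (J * ∑ b : TorusSite 3 L × Fin 3, Real.cos (θ (b.1 + Pi.single b.2 1) - θ b.1))) = Set.univ :=
    Set.eq_univ_of_forall fun θ => (Real.exp_pos _).ne'
  rw [hsupp, Measure.restrict_apply_univ]
  exact volume_cube_pos

/-- `|Σ_{x,y} ∫ cos(θ_x − θ_y) e^{J Σ cos}| ≤ L⁶ ∫ e^{J Σ cos}`. -/
theorem abs_num_real_le [NeZero L] (J : ℝ) :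
    |∑ x : TorusSite 3 L, ∑ y : TorusSite 3 L, ∫ θ in cube L, Real.cos (θ x - θ y) *
        Real.exp (J * ∑ b : TorusSite 3 L × Fin 3, Real.cos (θ (b.1 + Pi.single b.2 1) - θ b.1))| ≤
      (L : ℝ) ^ 6 * ∫ θ in cube L,
        Real.exp (J * ∑ b : TorusSite 3 L × Fin 3, Real.cos (θ (b.1 + Pi.single b.2 1) - θ b.1)) := by
  set w : (TorusSite 3 L → ℝ) → ℝ := fun θ =>
    Real.exp (J * ∑ b : TorusSite 3 L × Fin 3, Real.cos (θ (b.1 + Pi.single b.2 1) - θ b.1)) with hw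
  have hwc : Continuous w := continuous_xyWeight J
  have hwpos : ∀ θ, 0 < w θ := fun θ => Real.exp_pos _
  have hint : IntegrableOn w (cube L) volume := hwc.continuousOn.integrableOn_compact ent_isCompact_cube
  have hterm : ∀ x y : TorusSite 3 L, |∫ θ in cube L, Real.cos (θ x - θ y) * w θ| ≤ ∫ θ in cube L, w θ := by
    intro x y
    calc |∫ θ in cube L, Real.cos (θ x - θ y) * w θ|
        ≤ ∫ θ in cube L, |Real.cos (θ x - θ y) * w θ| := abs_integral_le_integral_abs
      _ ≤ ∫ θ in cube L, w θ := by
          refine integral_mono_of_nonneg (ae_of_all _ fun θ => abs_nonneg _) hint (ae_of_all _ fun θ => ?_)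
          show |Real.cos (θ x - θ y) * w θ| ≤ w θ
          rw [abs_mul, abs_of_pos (hwpos θ)]
          exact mul_le_of_le_one_left (hwpos θ).le (Real.abs_cos_le_one _)
  calc |∑ x : TorusSite 3 L, ∑ y : TorusSite 3 L, ∫ θ in cube L, Real.cos (θ x - θ y) * w θ|
      ≤ ∑ x : TorusSite 3 L, |∑ y : TorusSite 3 L, ∫ θ in cube L, Real.cos (θ x - θ y) * w θ| :=
        Finset.abs_sum_le_sum_abs _ _
    _ ≤ ∑ x : TorusSite 3 L, ∑ y : TorusSite 3 L, |∫ θ in cube L, Real.cos (θ x - θ y) * w θ| :=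
        Finset.sum_le_sum fun x _ => Finset.abs_sum_le_sum_abs _ _
    _ ≤ ∑ x : TorusSite 3 L, ∑ y : TorusSite 3 L, ∫ θ in cube L, w θ := by
        gcongr with x _ y _; exact hterm x y
    _ = (L : ℝ) ^ 6 * ∫ θ in cube L, w θ := by
        simp only [Finset.sum_const, Finset.card_univ, nsmul_eq_mul, Fintype.card_fun, Fintype.card_fin, ZMod.card]
        push_cast; ring

/-- `‖cratio L J 0‖ ≤ 1`: the real plateau is an average of cosines under a probability measure. -/
theorem norm_cratio_zero_le_one [NeZero L] (J : ℝ) : ‖cratio L J (0 : Bond L → Bond L → ℂ)‖ ≤ 1 := by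
  have hZ := integral_xyWeight_pos (L := L) J
  have hL : (0:ℝ) < (L : ℝ) ^ 6 := by
    have := NeZero.pos L; positivity
  unfold cratio
  rw [even_num_zero_eq, even_Zk_zero_eq, norm_div, norm_div, Complex.norm_real, Complex.norm_real, Real.norm_eq_abs,
    Real.norm_eq_abs]
  have hcube : (Set.pi Set.univ fun _ : TorusSite 3 L => Set.Icc (0 : ℝ) (2 * Real.pi)) = cube L := rfl
  simp only [hcube]
  rw [abs_of_pos hZ]
  have : ‖((L : ℂ)) ^ 6‖ = (L : ℝ) ^ 6 := by simp
  rw [this, div_div, div_le_one (by positivity), mul_comm]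
  exact abs_num_real_le J

/-- Small tori: by Griffiths' first inequality (`stub_twoPointNonneg`) every off-diagonal term is non-negative, so the plateau
is at least its diagonal part `L⁻³` (`J ≥ 0`). -/
theorem inv_cube_le_re_cratio_zero [NeZero L] {J : ℝ} (hJ : 0 ≤ J) :
    ((L : ℝ) ^ 3)⁻¹ ≤ (cratio L J (0 : Bond L → Bond L → ℂ)).re := by
  set w : (TorusSite 3 L → ℝ) → ℝ := fun θ =>
    Real.exp (J * ∑ b : TorusSite 3 L × Fin 3, Real.cos (θ (b.1 + Pi.single b.2 1) - θ b.1)) with hw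
  have hZ : 0 < ∫ θ in cube L, w θ := integral_xyWeight_pos (L := L) J
  have hL0 : (0:ℝ) < (L : ℝ) := by exact_mod_cast NeZero.pos L
  have hre : (cratio L J (0 : Bond L → Bond L → ℂ)).re =
      (∑ x : TorusSite 3 L, ∑ y : TorusSite 3 L, ∫ θ in cube L, Real.cos (θ x - θ y) * w θ) /
        ((∫ θ in cube L, w θ) * (L : ℝ) ^ 6) := by
    rw [even_re_cratio_zero]; rfl
  have hnn : ∀ x y : TorusSite 3 L, 0 ≤ ∫ θ in cube L, Real.cos (θ x - θ y) * w θ :=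
    fun x y => stub_twoPointNonneg J hJ L x y
  -- diagonal terms: `∫ cos 0 · w = Z₀`
  have hdiag : ∀ x : TorusSite 3 L, ∫ θ in cube L, Real.cos (θ x - θ x) * w θ = ∫ θ in cube L, w θ := by
    intro x; refine integral_congr_ae (ae_of_all _ fun θ => ?_); simp
  have hsum : (L : ℝ) ^ 3 * ∫ θ in cube L, w θ ≤
      ∑ x : TorusSite 3 L, ∑ y : TorusSite 3 L, ∫ θ in cube L, Real.cos (θ x - θ y) * w θ := by
    calc (L : ℝ) ^ 3 * ∫ θ in cube L, w θ
        = ∑ x : TorusSite 3 L, ∫ θ in cube L, Real.cos (θ x - θ x) * w θ := by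
          simp only [hdiag, Finset.sum_const, Finset.card_univ, nsmul_eq_mul, Fintype.card_fun, Fintype.card_fin,
            ZMod.card]
          push_cast; ring
      _ ≤ ∑ x : TorusSite 3 L, ∑ y : TorusSite 3 L, ∫ θ in cube L, Real.cos (θ x - θ y) * w θ := by
          refine Finset.sum_le_sum fun x _ => ?_
          rw [← Finset.add_sum_erase _ _ (Finset.mem_univ x)]
          exact le_add_of_nonneg_right (Finset.sum_nonneg fun y _ => hnn x y)
  rw [hre, le_div_iff₀ (by positivity)]
  calc ((L : ℝ) ^ 3)⁻¹ * ((∫ θ in cube L, w θ) * (L : ℝ) ^ 6) = (L : ℝ) ^ 3 * ∫ θ in cube L, w θ := by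
        field_simp
    _ ≤ _ := hsum

/-! ### Milestone 0: the `K = 0` plateau on every torus -/

/-- **The unperturbed plateau, all tori.** There are `J₁` and `a₀ > 0` such that for every `J ≥ J₁` and every `L ≥ 2` the
`K = 0` plateau `Re cratio L J 0 = L⁻⁶ Σ_{x,y} ⟨cos(θ_x − θ_y)⟩_{J,L}` of the plane rotator on `(ℤ/Lℤ)³` lies in `[a₀, 1]`:
even `L ≥ 4` by the Fröhlich–Simon–Spencer infrared bound (`stub_realPlateauEven`), odd `L ≥ L₁` by the reflection-positivity-free
long-range order of Garban–Spencer transported to the torus by Ginibre's inequality (`stub_realPlateauOdd`), and the finitely many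
remaining tori by Griffiths' first inequality and the diagonal (`inv_cube_le_re_cratio_zero`). This is Milestone 0 (`K = 0`) of
the crux `PerturbedXYOrder`, for ALL `L ≥ 2` (print covers even `L` only). -/
theorem realPlateau :
    ∃ J₁ a₀ : ℝ, 0 < a₀ ∧ ∀ J : ℝ, J₁ ≤ J → ∀ (L : ℕ) [NeZero L], 2 ≤ L →
      a₀ ≤ (cratio L J 0).re ∧ ‖cratio L J 0‖ ≤ 1 := by
  obtain ⟨J₁, a₁, ha₁, hE⟩ := stub_realPlateauEven
  obtain ⟨J₂, a₂, L₁, ha₂, hO⟩ := stub_realPlateauOdd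
  set a₃ : ℝ := ((max L₁ 4 : ℕ) : ℝ)⁻¹ ^ 3 with ha₃def
  have ha₃ : 0 < a₃ := by positivity
  refine ⟨max (max J₁ J₂) 0, min (min a₁ a₂) a₃, by positivity, fun J hJ L _ hL => ⟨?_, norm_cratio_zero_le_one J⟩⟩
  have hJ₁ : J₁ ≤ J := le_trans (le_trans (le_max_left J₁ J₂) (le_max_left _ 0)) hJ
  have hJ₂ : J₂ ≤ J := le_trans (le_trans (le_max_right J₁ J₂) (le_max_left _ 0)) hJ
  have hJ0 : 0 ≤ J := le_trans (le_max_right _ 0) hJ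
  by_cases h : Even L ∧ 4 ≤ L
  · exact (min_le_left _ _).trans ((min_le_left _ _).trans (hE J hJ₁ L h.1 h.2))
  by_cases h' : Odd L ∧ L₁ ≤ L
  · exact (min_le_left _ _).trans ((min_le_right _ _).trans (hO J hJ₂ L h'.1 h'.2))
  -- small torus: `L < max L₁ 4`
  have hsmall : L < max L₁ 4 := by
    rcases Nat.even_or_odd L with he | ho
    · have : ¬ 4 ≤ L := fun h4 => h ⟨he, h4⟩
      omega
    · have : ¬ L₁ ≤ L := fun h1 => h' ⟨ho, h1⟩
      omega
  refine (min_le_right _ _).trans (le_trans ?_ (inv_cube_le_re_cratio_zero hJ0))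
  rw [ha₃def, inv_pow]
  have hL0 : (0:ℝ) < (L : ℝ) := by exact_mod_cast NeZero.pos L
  have hle : (L : ℝ) ≤ ((max L₁ 4 : ℕ) : ℝ) := by exact_mod_cast hsmall.le
  exact inv_anti₀ (by positivity) (pow_le_pow_left₀ hL0.le hle 3)

/-! ### Complex stability from cumulant bounds, and the crux -/

/-- **Complex stability from Gevrey-1 Taylor bounds.** If for `J ≥ J₃`, `L ≥ 2` and every kernel admissible at radius `ε₁` the
Taylor coefficients at `t = 0` of `log(Z(tK)/Z(0))` are bounded by `Aⁿ L³` and those of `cratio(tK)` by `Aⁿ` (`n ≥ 1`), then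
every kernel admissible at radius `ε₁/(2A)` has `Z ≠ 0` and `‖cratio‖ ≤ 2` (`stub_entire` + `stub_stabilityOfTaylorBounds` on the
ray through `(2A) • K` at `t = 1/(2A)`, + `‖cratio 0‖ ≤ 1`). -/
theorem complexStability_of_cumulantBounds {J₃ ε₁ A : ℝ} (hA : 0 < A)
    (hC : ∀ J : ℝ, J₃ ≤ J → ∀ (L : ℕ) [NeZero L], 2 ≤ L →
      ∀ K : Bond L → Bond L → ℂ, Admissible L ε₁ K →
        (∀ n : ℕ, 1 ≤ n →
          ‖iteratedDeriv n (fun t : ℂ => Complex.log (Zk J (t • K) / Zk J (0 : Bond L → Bond L → ℂ))) 0‖ ≤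
            (n.factorial : ℝ) * A ^ n * (L : ℝ) ^ 3) ∧
        (∀ n : ℕ, 1 ≤ n → ‖iteratedDeriv n (fun t : ℂ => cratio L J (t • K)) 0‖ ≤ (n.factorial : ℝ) * A ^ n)) :
    ∀ J : ℝ, J₃ ≤ J → ∀ (L : ℕ) [NeZero L], 2 ≤ L →
      ∀ K : Bond L → Bond L → ℂ, Admissible L (ε₁ / (2 * A)) K → Zk J K ≠ 0 ∧ ‖cratio L J K‖ ≤ 2 := by
  intro J hJ L _ hL K hK
  set c : ℝ := 2 * A with hc
  have hcpos : 0 < c := by positivity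
  have hbig : Admissible L ε₁ (((c : ℝ) : ℂ) • K) := by
    refine sch_admissible_smul (le_of_eq ?_) hK
    rw [Complex.norm_real, Real.norm_eq_abs, abs_of_pos hcpos]
    field_simp
  obtain ⟨h1, h2⟩ := hC J hJ L hL _ hbig
  have hent := stub_entire J L (((c : ℝ) : ℂ) • K)
  have hZ0 : Zk J (0 : Bond L → Bond L → ℂ) ≠ 0 := by
    rw [even_Zk_zero_eq, Ne, Complex.ofReal_eq_zero]
    exact (integral_xyWeight_pos (L := L) J).ne'
  have h3 := stub_stabilityOfTaylorBounds J L (((c : ℝ) : ℂ) • K) A ((L : ℝ) ^ 3) hA (by positivity)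
    hent.1 hent.2 hZ0 h1 h2 (((1 / c : ℝ)) : ℂ) (by
      rw [Complex.norm_real, Real.norm_eq_abs, abs_of_pos (by positivity), hc])
  have hsmul : (((1 / c : ℝ)) : ℂ) • ((((c : ℝ) : ℂ)) • K) = K := by
    rw [smul_smul, ← Complex.ofReal_mul, one_div_mul_cancel hcpos.ne', Complex.ofReal_one, one_smul]
  rw [hsmul] at h3
  refine ⟨h3.1, ?_⟩
  calc ‖cratio L J K‖ = ‖(cratio L J K - cratio L J 0) + cratio L J 0‖ := by rw [sub_add_cancel]
    _ ≤ ‖cratio L J K - cratio L J 0‖ + ‖cratio L J 0‖ := norm_add_le _ _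
    _ ≤ 1 + 1 := add_le_add h3.2 (norm_cratio_zero_le_one J)
    _ = 2 := by norm_num

/-- **The crux from the cumulant bounds** (the reduction achieved by the line `schwarz-inheritance`). If there are `J₀, ε₁ > 0,
A > 0` such that for all `J ≥ J₀`, `L ≥ 2` and all kernels `K` admissible at radius `ε₁` the Taylor coefficients at `t = 0` of
`t ↦ log(Z(tK)/Z(0))` are bounded by `Aⁿ L³` and those of `t ↦ cratio L J (tK)` by `Aⁿ` (`n ≥ 1`; these are the cumulants of `W_K`
per unit `n!`, resp. the mixed cumulants with the order observable, under the REAL Gibbs state `μ_{J,L}`), then `PerturbedXYOrder`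
holds, with `ε = ε₁/(2A) · a₀/8` and `a = a₀/2` (`a₀` from `realPlateau`): complex stability at radius `ε₁/(2A)` with `B = 2`
(`complexStability_of_cumulantBounds`) and Schwarz inheritance (`stub_schwarzInheritance`). -/
theorem perturbedXYOrder_of_cumulantBounds :
    (∃ J₀ ε₁ A : ℝ, 0 < ε₁ ∧ 0 < A ∧ ∀ J : ℝ, J₀ ≤ J → ∀ (L : ℕ) [NeZero L], 2 ≤ L →
      ∀ K : Bond L → Bond L → ℂ, Admissible L ε₁ K →
        (∀ n : ℕ, 1 ≤ n →
          ‖iteratedDeriv n (fun t : ℂ => Complex.log (Zk J (t • K) / Zk J (0 : Bond L → Bond L → ℂ))) 0‖ ≤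
            (n.factorial : ℝ) * A ^ n * (L : ℝ) ^ 3) ∧
        (∀ n : ℕ, 1 ≤ n → ‖iteratedDeriv n (fun t : ℂ => cratio L J (t • K)) 0‖ ≤ (n.factorial : ℝ) * A ^ n)) →
    PerturbedXYOrder := by
  rintro ⟨J₃, ε₁, A, hε₁, hA, hC⟩
  rw [perturbedXYOrder_iff]
  obtain ⟨J₁, a₀, ha₀, hplat⟩ := realPlateau
  have hstab := complexStability_of_cumulantBounds hA hC
  refine ⟨max J₁ J₃, ε₁ / (2 * A) * a₀ / (4 * 2), a₀ / 2, by positivity, by positivity, ?_⟩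
  intro J hJ L _ hL K hK
  exact stub_schwarzInheritance J L (ε₁ / (2 * A)) 2 a₀ (by positivity) ha₀ (fun K' => stub_entire J L K')
    (hstab J (le_trans (le_max_right _ _) hJ) L hL) (hplat J (le_trans (le_max_left _ _) hJ) L hL).1 K hK

/-- **The crux from complex stability** (the line's lever in its cleanest form, card `schwarz-inheritance` Transfer C⁺).
If there are `J₀`, `ε₂ > 0`, `B > 0` such that for all `J ≥ J₀`, `L ≥ 2` and all kernels admissible at radius `ε₂` the perturbed
partition function does not vanish and the complex plateau is bounded, `Z_K ≠ 0 ∧ ‖cratio L J K‖ ≤ B`, then `PerturbedXYOrder`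
holds with `ε = ε₂ a₀/(4B)`, `a = a₀/2` (`realPlateau` + `stub_entire` + `stub_schwarzInheritance`). No lower bound and no order
statement for any complex object is required: the Schwarz radius absorbs `B`. (`complexStability_of_cumulantBounds` shows that
Gevrey-1 cumulant bounds under the real Gibbs state suffice for the hypothesis.) -/
theorem perturbedXYOrder_of_complexStability :
    (∃ J₀ ε₂ B : ℝ, 0 < ε₂ ∧ 0 < B ∧ ∀ J : ℝ, J₀ ≤ J → ∀ (L : ℕ) [NeZero L], 2 ≤ L →
      ∀ K : Bond L → Bond L → ℂ, Admissible L ε₂ K → Zk J K ≠ 0 ∧ ‖cratio L J K‖ ≤ B) →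
    PerturbedXYOrder := by
  rintro ⟨J₀, ε₂, B, hε₂, hB, hCS⟩
  rw [perturbedXYOrder_iff]
  obtain ⟨J₁, a₀, ha₀, hplat⟩ := realPlateau
  refine ⟨max J₀ J₁, ε₂ * a₀ / (4 * B), a₀ / 2, by positivity, by positivity, ?_⟩
  intro J hJ L _ hL K hK
  exact stub_schwarzInheritance J L ε₂ B a₀ hε₂ ha₀ (fun K' => stub_entire J L K')
    (hCS J (le_trans (le_max_left _ _) hJ) L hL) (hplat J (le_trans (le_max_right _ _) hJ) L hL).1 K hK

end Summit.HubbardSuperconductivity.HubbardSuperconductivity.Theorems.PerturbedXYOrder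

end
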